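import Summits.QuantumFields.BalabanUV.T4Continuum.Support.NE9SizeFedCouplingSpecies

/-!
# NE9SizeFedCouplingSpeciesReadOut — the READ-OUT twin of `NE9SizeFedCouplingSpecies` §3: the NE9 END (`…_margProj` face,
# `P := margProj r A`) at the ASSEMBLED species channel 𝒯 = cpieceChannel D.toC + cpieceChannel K.toC with leaf A3's coupling
# modulus PRODUCED, size-fed, from A3-CUR (p214647) + A3-KER (p214870) via `tcup_species_proj`
# (cell `pub-balaban`, T4-DAG §2 node U3 ∕ §6 NE9; NE9 formalisation swarm, unit `b2b-balaban-t4-ne9-formalise-leaf-05` gen 6;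
# own-lineage follow-through «A3-FED-SPECIES» part 2 of 2 — the ≤ 400-line rule splits it off the sibling; CLAIMS.log; at own risk)

HONEST FRAMING (T4-DAG PAGE 1).  Rung (B)+1 of the FINITE-VOLUME T⁴ programme — NOT infinite volume, NOT a mass gap, NOT the
Clay problem.  NE9 (`T4OutputRate.NE9` ∧ `FadingMemory`) is a cell NEW ESTIMATE, NOT PRINTED, NOT discharged here («NE9 ⇐ the
named binders»); spine 0∕9; 0∕18 skeleton leaves instantiated on Bałaban's objects (O-NE9-1).  HONEST DEPENDENCY (cell line,
verbatim): continuum YM on T⁴ ⇐ BetaPertH ∧ nine spine estimates (0/9 proved); BetaPertH ⇐ (D1) ∧ (D4) ∧ CAP+tail; G-an2-4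
gates asym, D1 and NE2/3/4.  [I] = [Balaban1987RG1] (CMP **109**), [II] = [Balaban1988RG2Cluster] (CMP **116**) are quoted for
TYPES only (ABSOLUTE RULE: nothing printed in the audited series is asserted).  No `def`, no Prop-valued definition;
`FlowStep.BetaPertH`, (B), (B^μ) do not occur.

WHAT THIS FILE IS.  **`termSize_ne9_and_fadingMemory_species_margProj_fedA3`** — END-M's `…_margProj` face
(`NE9MarginalProjectionEnd.ne9_and_fadingMemory_of_couplingTwoPoint_vacSub_sizeInduction_margProj`; read-out projection
`P := margProj r A` of [I] (1.3) p. 260 ∕ (1.20)–(1.22) p. 264 with RO ∕ AW binders `hrA hr0 hrs hA hcr haA` and the displayed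
`hPinto : ProjInto Adm MF (margProj r A)`) AT THE ASSEMBLED SPECIES CHANNEL with: S-SUM ∕ S5 ∕ S3 ∕ profile of the sum assembled BY
NAME exactly as in the owner's p215007 (`channelStepSum_add` ∘ `channelStepSum_cpiece` ×2; `channelSizeAtStepNN_add_cpiece` ∘
`channelSizeAtStepNN_cur` ∕ `_ker` on `MF`; `channelAdditive_add` of the two displayed `PieceAdditiveOn`; `profile_species`), the
size FIRST (A3-FED §2 `termSize_ne9_and_fadingMemory_margProj_fed`, p215358) and leaf A3's `hTcup` PRODUCED by the sibling's
`tcup_species_proj` at `projScaleComm_margProj` ∕ `projSize_margProj` (`c := cr·a_A`; the projected family's analyticity from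
`hPinto` + `MF ⊆ analyticClass`, its size from `termSize_proj`).  Binders: the sibling's §3 list with the projection quadruple
`hPadd hPcomm hPinto hPsize hc` ↦ `hrA hr0 hrs hA hcr haA hPinto`; `hqTb` is the ONE scalar inequality
`(64·clip·cQ_(a) + λ·cQ_(b))·((1 + cr·a_A)·N̄)·(1 − ω)⁻¹ ≤ qTbar` (`qTbar` symbolic, c6).  Conclusion LITERALLY END-M `…_margProj`'s
at `τ̄ := cQ_(a) + cQ_(b)`.  NOT PRINTED and not claimed: that Bałaban's curves ∕ kernels ∕ probes meet these binders (O-NE9-1 ∕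
O-NE9-5).  DISGUISE TEST: one input family, two values of the LAST coupling, size first — leaf A3 bookkeeping, not NE9.

References (TYPES only): [Balaban1987RG1] T. Bałaban, CMP **109** (1987) 249–301, (0.28)–(0.29) p. 258, (1.3) p. 260, (1.18)
p. 263, (1.20)–(1.22) p. 264, (3.53)–(3.54) p. 280, (4.22) p. 286; [Balaban1988RG2Cluster] T. Bałaban, CMP **116** (1988) 1–22,
(1.23)–(1.29) pp. 7–8, (1.33)–(1.36) p. 9, (2.14)–(2.15) p. 15.  Summits-side NEW work (LEAN PLACEMENT RULE); imports the sibling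
`NE9SizeFedCouplingSpecies` ONLY; modifies nothing; no END face re-wired.  Value = bookkeeping, NOT summit progress.
-/

noncomputable section

namespace Summit.QuantumFields.BalabanUV.T4Continuum.NE9SizeFedCouplingSpeciesReadOut

open scoped BigOperators
open Metric Set
open Literature.Probability.LatticeModels
open Literature.MathematicalPhysics.QuantumFieldTheory.Balaban1983to89
open Literature.MathematicalPhysics.QuantumFieldTheory.Balaban1983to89.T4OutputRate
open Literature.MathematicalPhysics.QuantumFieldTheory.Balaban1983to89.T4HistoryLipschitzRecursion
open Literature.MathematicalPhysics.QuantumFieldTheory.Balaban1983to89.T4HistoryLipschitzOuter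
open Literature.MathematicalPhysics.QuantumFieldTheory.Balaban1983to89.T4HistoryLipschitzActivity
open Literature.MathematicalPhysics.QuantumFieldTheory.Balaban1983to89.T4HistoryLipschitzActivity (ClusterGeom)
open Literature.MathematicalPhysics.QuantumFieldTheory.Balaban1983to89.T4HistoryLipschitzSegment
open Summit.QuantumFields.BalabanUV.T4Continuum.NE9Lemma1Counting
open Summit.QuantumFields.BalabanUV.T4Continuum.NE9Lemma1Gain
open Summit.QuantumFields.BalabanUV.T4Continuum.NE9Lemma1PieceClass
open Summit.QuantumFields.BalabanUV.T4Continuum.NE9Lemma1RemainderSpecies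
open Summit.QuantumFields.BalabanUV.T4Continuum.NE9Lemma1CurveSpecies
open Summit.QuantumFields.BalabanUV.T4Continuum.NE9Lemma1KernelSpecies
open Summit.QuantumFields.BalabanUV.T4Continuum.NE9Lemma1RemainderSpeciesEnd (channelSizeAtStepNN_mono pieceAdditiveOn_mono)
open Summit.QuantumFields.BalabanUV.T4Continuum.NE9Lemma1SpeciesEnd (profile_species)
open Summit.QuantumFields.BalabanUV.T4Continuum.NE9ComplexEncoding (doubleCarriers)
open Summit.QuantumFields.BalabanUV.T4Continuum.NE9MarginalProjection
open Summit.QuantumFields.BalabanUV.T4Continuum.NE9MarginalProjectionEnd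
open Summit.QuantumFields.BalabanUV.T4Continuum.NE9ChannelSum
open Summit.QuantumFields.BalabanUV.T4Continuum.NE9SizeFedCoupling
open Summit.QuantumFields.BalabanUV.T4Continuum.NE9SizeFedCouplingSpecies (tcup_species_proj)

section Species

variable {C₀ : Carriers} {E : Type} [NormedAddCommGroup E] [NormedSpace ℂ E]
  {ι α β γ δ α' β' γ' δ' Pt : Type} [DecidableEq δ] [DecidableEq δ']

/-! ## The READ-OUT face (`P := margProj r A`) at the assembled species with leaf A3 PRODUCED -/

/-- **THE NE9 END (`…_margProj` face) AT THE ASSEMBLED SPECIES CHANNEL WITH ITS COUPLING MODULUS PRODUCED (kernel).**  The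
read-out projection `P := margProj r A` ([I] (1.3) ∕ (1.20)–(1.22)): RO ∕ AW binders `hrA hr0 hrs hA hcr haA` and the displayed
`hPinto : ProjInto Adm MF (margProj r A)` as in END-M `…_margProj`; `c := cr·a_A`; otherwise the sibling's §3 list.  Proof: the
p215007 assembly + A3-FED §2 `termSize_ne9_and_fadingMemory_margProj_fed` fed with the sibling's `tcup_species_proj` at `projScaleComm_margProj` ∕
`projSize_margProj`.
Conclusion LITERALLY END-M `…_margProj`'s at `𝒯 := cpieceChannel D.toC + cpieceChannel K.toC`, `τ̄ := cQ_(a) + cQ_(b)`.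
[cite: Balaban1987RG1, (0.28)-(0.29) p.258, (1.3) p.260, (1.18) p.263, (1.20)-(1.22) p.264, (3.53)-(3.54) p.280, (4.22) p.286; Balaban1988RG2Cluster, (1.23)-(1.29) pp.7-8, (1.33)-(1.36) p.9, (2.14)-(2.15) p.15] -/
theorem termSize_ne9_and_fadingMemory_species_margProj_fedA3 (G : ClusterGeom (doubleCarriers C₀)) {Pot : Type*}
    [NormedAddCommGroup Pot] [NormedSpace ℂ Pot] {D : CurData C₀ E ι α β γ δ} {K : KerData C₀ E ι α' β' γ' δ' Pt}
    {ℓg ℓk gain : ℕ → ℕ → ℝ} {cdir cK δ₀ δ₁ w w0 c0 c1 d0 O1 cQa cQb : ℝ}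
    {Ef : Functional (doubleCarriers C₀) E} {W : Set (ℕ → ℝ)}
    {Adm MF : Set (E → (doubleCarriers C₀).Dom → ℝ)}
    {r : ℕ → (E → (doubleCarriers C₀).Dom → ℝ) → ℝ} {A : E → (doubleCarriers C₀).Dom → ℝ}
    {Ψ : ℕ → ℝ → (ι → ℝ) → E → (doubleCarriers C₀).Dom → ℝ} {act : ℕ → ℝ → E → Pot → G.P → ℂ} {𝒜 : ℕ → Set Pot}
    {n : ℕ → ℝ → E → G.P → ℝ} {lip clip : ℕ → ℝ} {a d : G.P → ℝ} {δv : (doubleCarriers C₀).Dom → ℝ}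
    {κ B lipbar clipbar qTbar ω cr aA Nbar clipa lam : ℝ} {p₀ N : ℕ → ℝ}
    -- species (a)
    (hD : D.Admissible ℓg cdir d0) (hℓ : ∀ k j, 0 < ℓg k j)
    (hLa : LevelCountsG D.toC.frame κ D.κ₁ O1 cQa (fun k j => ℓg k j ^ 5) (agePow ω))
    (hAa : PieceAdditiveOn (analyticClass D.R) D.toC)
    (hclipa : 0 ≤ clipa) (hcdir : 0 < cdir) (hhalf : ∀ k j, cdir * ℓg k j < 1 / 2)
    (hcont : ∀ (k : ℕ) (s : ℕ → ℝ) (y : ι) (a : α) (b : β) (x : (doubleCarriers C₀).Dom),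
      ContinuousOn (fun q : (ℂ × ((δ → ℝ) × (δ → ℂ))) × ℂ => D.cur k s y a b x q.1.1 q.1.2.1 q.1.2.2 q.2)
        ((sphere (0:ℂ) (D.r k) ×ˢ {q | OnContour D.κ₁ (D.cubes k y a b) q.1 q.2}) ×ˢ sphere (0:ℂ) 1))
    (hlip : ∀ g ∈ W, ∀ g' ∈ W, ∀ (k : ℕ) (y : ι), ∀ a ∈ D.S0 k y, ∀ b ∈ D.SY k y a, ∀ (j : ℕ), ∀ x ∈ D.src k y a j,
      ∀ t ∈ sphere (0:ℂ) (D.r k), ∀ (s' : δ → ℝ) (σ' : δ → ℂ), OnContour D.κ₁ (D.cubes k y a b) s' σ' →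
        ∀ τ ∈ ball (0:ℂ) (1 / (2 * (cdir * ℓg k j))),
          ‖D.cur k g y a b x t s' σ' τ - D.cur k g' y a b x t s' σ' τ‖ ≤ clipa * (D.R x.1 / 2) * |g k - g' k|)
    (hroom : ∀ g ∈ W, ∀ (k : ℕ) (y : ι), ∀ a ∈ D.S0 k y, ∀ b ∈ D.SY k y a, ∀ (j : ℕ), ∀ x ∈ D.src k y a j,
      ∀ t ∈ sphere (0:ℂ) (D.r k), ∀ (s' : δ → ℝ) (σ' : δ → ℂ), OnContour D.κ₁ (D.cubes k y a b) s' σ' →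
        ∀ τ ∈ ball (0:ℂ) (1 / (2 * (cdir * ℓg k j))), ‖D.cur k g y a b x t s' σ' τ‖ ≤ D.R x.1 / 2)
    -- species (b)
    (hK : K.Admissible ℓk gain cK δ₀ δ₁ w w0 c0 c1 d0) (hκ₁ : K.κ₁ = D.κ₁) (hR : K.R = D.R)
    (hdY : K.toC.frame.dY = D.toC.frame.dY)
    (hLb : LevelCountsG K.toC.frame (κ - w) K.κ₁ O1 cQb gain (agePow ω))
    (hAb : PieceAdditiveOn (analyticClass K.R) K.toC) (hlam : 0 ≤ lam)
    (hkerC : ∀ (k : ℕ) (s : ℕ → ℝ) (y : ι) (a : α') (b : β') (x : (doubleCarriers C₀).Dom), ∀ p ∈ K.pts k y a,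
      ∀ q ∈ K.pts k y a, ∀ F : E → ℂ, DifferentiableOn ℂ F (ball 0 (K.R x.1)) →
        Continuous fun wv : ℂ × (δ' → ℝ) × (δ' → ℂ) => K.ker k s y a b x wv.1 wv.2.1 wv.2.2 p q F)
    (hkerL : ∀ g ∈ W, ∀ g' ∈ W, ∀ (k : ℕ) (y : ι), ∀ a ∈ K.S0 k y, ∀ b ∈ K.SY k y a, ∀ (j : ℕ), ∀ x ∈ K.src k y a j,
      ∀ t ∈ sphere (0:ℂ) (K.r k), ∀ (s' : δ' → ℝ) (σ' : δ' → ℂ), OnContour K.κ₁ (K.cubes k y a b) s' σ' →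
        ∀ p ∈ K.pts k y a, ∀ q ∈ K.pts k y a, ∀ (F : E → ℂ) (M : ℝ),
          DifferentiableOn ℂ F (ball 0 (K.R x.1)) → (∀ z ∈ ball (0:E) (K.R x.1), ‖F z‖ ≤ M) →
            ‖K.ker k g y a b x t s' σ' p q F - K.ker k g' y a b x t s' σ' p q F‖ ≤
              cK * lam * M * gain k j * K.ρd p q ^ K.m * Real.exp (-(δ₀ * (K.dX x.1 p + K.dX x.1 q))) * |g k - g' k|)
    (hO1 : 0 ≤ O1) (hcQa : 0 ≤ cQa) (hcQb : 0 ≤ cQb) (hMF : MF ⊆ analyticClass D.R)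
    -- the face's binders (END-M `…_margProj`), at 𝒯 := cpieceChannel D.toC + cpieceChannel K.toC — minus `hTcup` ∕ `hqT0`
    (ρ : ℕ → (ι → ℝ) → Pot) (U₀ : E) (explZ : ℕ → E → (doubleCarriers C₀).Dom → ℝ) (h0 : ScaleZeroFree Ef W)
    (hAdm : AdmissibleTerms Ef W Adm) (hres : AdmRestrict Adm)
    (hrA : ReadAdditive Adm r) (hr0 : ReadZero r) (hrs : ReadSize Adm r κ cr) (hA : DirSize A κ aA) (hcr : 0 ≤ cr)
    (haA : 0 ≤ aA) (hPinto : ProjInto Adm MF (margProj r A))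
    (hfac : Factorises Ef W (compProj (cpieceChannel D.toC + cpieceChannel K.toC) (margProj r A)) Ψ)
    (hclip0 : ∀ k, 0 ≤ clip k)
    (hCup : ∀ g ∈ W, ∀ g' ∈ W, ∀ (k : ℕ) (U : E) (X : (doubleCarriers C₀).Dom), (doubleCarriers C₀).scale X = k + 1 →
      ∀ Q ∈ 𝒜 k, ∀ γ' ∈ G.vol X,
      ‖act k (g k) U Q γ'‖ ≤ n k (g' k) U γ' ∧
        ‖act k (g k) U Q γ' - act k (g' k) U Q γ'‖ ≤ clip k * |g k - g' k| * n k (g' k) U γ')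
    (hreprV : ∀ (k : ℕ) (s : ℝ) (Q : ι → ℝ) (U : E) (X : (doubleCarriers C₀).Dom),
      Ψ k s Q U X = (G.newTerm act k s U X (ρ k Q)).re - (G.newTerm act k s U₀ X (ρ k Q)).re + explZ k U X)
    (hclipb : ∀ k, clip k ≤ clipbar) (hNb : ∀ j, N j ≤ Nbar)
    (hqTb : (64 * clipa * cQa + lam * cQb) * ((1 + cr * aA) * Nbar) * (1 - ω)⁻¹ ≤ qTbar)
    (hKP : TwoPointKP G W act 𝒜 n lip a d) (hdec : G.DecayExtract δv d) (hpin : G.PinBudget a δv (fun _ => B) κ)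
    (hρ : ∀ (k : ℕ) (Q Q' : ι → ℝ) (M : ℝ),
      (∀ y, |Q y - Q' y| ≤ weightOf D.toC.frame D.κ₁ d0 O1 (D.Kp cdir + K.Kp cK w0 c0 c1) k y * M) →
        ‖ρ k Q - ρ k Q'‖ ≤ M)
    (hexplZ : ∀ (k : ℕ) (U : E) (X : (doubleCarriers C₀).Dom), (doubleCarriers C₀).scale X = k + 1 →
      |explZ k U X| ≤ Real.exp (-(κ * (doubleCarriers C₀).d X)) * p₀ k)
    (hbase : ∀ g ∈ W, ∀ (U : E) (X : (doubleCarriers C₀).Dom), (doubleCarriers C₀).scale X = 0 →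
      |Ef g U X| ≤ Real.exp (-(κ * (doubleCarriers C₀).d X)) * N 0)
    (hNsucc : ∀ j, p₀ j + 2 * B ≤ N (j + 1)) (hNnn : ∀ j, 0 ≤ N j)
    (hbox : ∀ (k : ℕ) (Q : ι → ℝ), (∀ y, |Q y| ≤ weightOf D.toC.frame D.κ₁ d0 O1 (D.Kp cdir + K.Kp cK w0 c0 c1) k y *
      sizeRadius (fun k j => (1 + cr * aA) * (tauOfG cQa (agePow ω) + tauOfG cQb (agePow ω)) k j) N k) → ρ k Q ∈ 𝒜 k)
    (hB : 0 ≤ B) (hlipb : ∀ k, lip k ≤ lipbar) (hω : 0 ≤ ω) (hω1 : ω < 1)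
    (hpos : 0 < ω + 8 * lipbar * B * ((1 + cr * aA) * (cQa + cQb))) :
    TermSize Ef W κ N ∧
      NE9 Ef W κ (prodModuli (8 * clipbar * B + 8 * lipbar * B * qTbar)
        fun _ => ω + 8 * lipbar * B * ((1 + cr * aA) * (cQa + cQb))) ∧
        FadingMemory ((8 * clipbar * B + 8 * lipbar * B * qTbar) / (ω + 8 * lipbar * B * ((1 + cr * aA) * (cQa + cQb))))
          (ω + 8 * lipbar * B * ((1 + cr * aA) * (cQa + cQb)))
          (prodModuli (8 * clipbar * B + 8 * lipbar * B * qTbar)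
            fun _ => ω + 8 * lipbar * B * ((1 + cr * aA) * (cQa + cQb))) := by
  have hℓg : ∀ k j, 0 ≤ ℓg k j := fun k j => (hℓ k j).le
  have hMFb : MF ⊆ analyticClass K.R := by rw [hR]; exact hMF
  have hsum : ChannelStepSum MF (cpieceChannel D.toC + cpieceChannel K.toC) :=
    channelStepSum_add (channelStepSum_cpiece (pieceZero_cur D) (pieceLocal_cur D) (csrcScale_cur hD) MF)
      (channelStepSum_cpiece (pieceZero_ker hK.kerZero) (pieceLocal_ker K) (csrcScale_ker hK) MF)
  have ha : ChannelSizeAtStepNN MF (cpieceChannel D.toC) κ (weightOf D.toC.frame D.κ₁ d0 O1 (D.Kp cdir))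
      (tauOfG cQa (agePow ω)) :=
    channelSizeAtStepNN_mono hMF
      (channelSizeAtStepNN_cur hD hℓg κ hLa hO1 (fun k j => mul_nonneg hcQa (agePow_nonneg hω k j)))
  have hb : ChannelSizeAtStepNN MF (cpieceChannel K.toC) κ (weightOf K.toC.frame D.κ₁ d0 O1 (K.Kp cK w0 c0 c1))
      (tauOfG cQb (agePow ω)) := by
    have h := channelSizeAtStepNN_mono hMFb
      (channelSizeAtStepNN_ker hK κ hLb hO1 (fun k j => mul_nonneg hcQb (agePow_nonneg hω k j)))
    rw [hκ₁] at h
    exact h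
  have hstep : ChannelSizeAtStepNN MF (cpieceChannel D.toC + cpieceChannel K.toC) κ
      (weightOf D.toC.frame D.κ₁ d0 O1 (D.Kp cdir + K.Kp cK w0 c0 c1))
      (tauOfG cQa (agePow ω) + tauOfG cQb (agePow ω)) :=
    channelSizeAtStepNN_add_cpiece D.toC K.toC hdY ha hb (kp_nonneg hD) (kp_nonneg_ker hK) hO1
      (fun k j _ => mul_nonneg hcQa (agePow_nonneg hω k j)) (fun k j _ => mul_nonneg hcQb (agePow_nonneg hω k j))
  have hadd : ChannelAdditive MF (cpieceChannel D.toC + cpieceChannel K.toC) :=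
    channelAdditive_add (channelAdditive_cpiece (pieceAdditiveOn_mono hMF hAa))
      (channelAdditive_cpiece (pieceAdditiveOn_mono hMFb hAb))
  have hτ := profile_species hcQa hcQb hω
  have hPE : ∀ g ∈ W, margProj r A (Ef g) ∈ analyticClass D.R := fun g hg => hMF (hPinto (Ef g) (hAdm.1 g hg))
  have hNbar : 0 ≤ Nbar := (hNnn 0).trans (hNb 0)
  have h1ω : 0 < 1 - ω := by linarith
  have hca : 0 ≤ cr * aA := mul_nonneg hcr haA
  have hq0 : 0 ≤ (64 * clipa * cQa + lam * cQb) * ((1 + cr * aA) * Nbar) * (1 - ω)⁻¹ := by positivity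
  exact termSize_ne9_and_fadingMemory_margProj_fed G ρ U₀ explZ h0 hAdm hres hrA hr0 hrs hA hcr haA hPinto hadd hsum hstep
    hfac hclip0 hCup (qT := fun _ => (64 * clipa * cQa + lam * cQb) * ((1 + cr * aA) * Nbar) * (1 - ω)⁻¹) (fun _ => hq0)
    (tcup_species_proj hres (projScaleComm_margProj Adm A hr0) (projSize_margProj hrs hA hcr) hca hAdm.1 hPE hNnn hNb hD
      hclipa hcdir hℓ hhalf hcont hlip hroom hLa hK hκ₁ hR hdY hlam hkerC hkerL hLb hO1 hcQa hcQb hω hω1)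
    hreprV hclipb (fun _ => hqTb) hKP hdec hpin hρ hexplZ hbase hNsucc hNnn hbox hB hlipb (add_nonneg hcQa hcQb) hω hpos hτ

end Species

end Summit.QuantumFields.BalabanUV.T4Continuum.NE9SizeFedCouplingSpeciesReadOut

end
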